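import Summits.BirchSwinnertonDyer.BirchSwinnertonDyer.Theses.LeadingTerm
import Summits.BirchSwinnertonDyer.BirchSwinnertonDyer.Theorems.LeadingTermPinchPrimeOpenStubsOfResidual
import Summits.BirchSwinnertonDyer.BirchSwinnertonDyer.Theorems.LeadingTermPinchPrimePinchAtOfOpenStubs
import Summits.BirchSwinnertonDyer.BirchSwinnertonDyer.Theorems.LeadingTermPinchPrimePinchPrimeOfOpenRanges
import Summits.BirchSwinnertonDyer.BirchSwinnertonDyer.Theorems.LeadingTermPinchPrimePinchAtOfSamePrime
import Literature.NumberTheory.EllipticCurves.SelmerCorankControlRatOrdinaryProofs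
import Literature.NumberTheory.EllipticCurves.BSDSha

/-!
# Crux `PinchPrime` (stmt-BirchSwinnertonDyer-16218) — route-level SPLIT certificate
# (crux-strategist s1, 2026-08-17): `PinchPrime ⟸ ShaFiniteCofinite(r_an ≥ 2) ∧ SchneiderIO(rank ≥ 1)`
# modulo five theorem-grade named facts

Helper file (`--supports stmt-BirchSwinnertonDyer-16218`). It certifies the decomposition filed on
route `LeadingTerm` by the crux strategist: the crux

  `LeadingTerm.PinchPrime` — every elliptic `E/ℚ` (globally minimal `W`) has ONE good ordinary
  `p ≥ 5` (with its canonical cyclotomic height datum and its newform `f`) at which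
  `ord_{T=0} L_p(f, α_p, T) = rank_ℤ E(ℚ)` —

is split into the two OPEN registered stubs of its only line `SketchIdeator2` (lead skeleton v24,
leads c0–c5), promoted VERBATIM to route items:

* (A′) `ShaFiniteCofiniteOfTwoLeAnalyticRank`: for every `E/ℚ` of analytic rank `≥ 2`,
  `Ш(E/ℚ)[p^∞]` is finite for all but finitely many good ordinary `p`
  (⊂ Tate–Shafarevich finiteness; implied by the shared item `SelmerRankShaPFinite`);
* (S′) `SchneiderInfinitelyOftenOfPosRank`: every `E/ℚ` of Mordell–Weil rank `≥ 1` that is not a CM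
  curve of rank `1` has, outside any finite set, a good ordinary `p ≥ 5` at which THE canonical
  cyclotomic `p`-adic height is non-degenerate (`Reg_p(E) ≠ 0`; the `∃^∞ p` weakening of
  Mazur–Stein–Tate 2006 Conj. 1.1 on exactly its open range);

with the glue `A′ → S′ → PinchPrime` PROVABLE MODULO five published theorems stated in the tree as
named facts (modularity `exists_isNewformOf`; the cyclotomic main conjecture under irreducibility
`burungale_castella_skinner_charIdeal_eq_padicLFunction`; Perrin-Riou–Schneider
`Schneider1985_order_charGenerator`; Gross–Zagier–Kolyvagin
`rank_eq_analyticRank_of_analyticRank_le_one`; Bertrand `bertrand_pairing_self_ne_zero_of_hasCM`)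
— exactly the registered facts stub `stub_theoremGradeFacts` of the line. The glue cannot be an
unconditional tree theorem before those facts have `_holds` companions, and the facts may not be
named inside a route item (staffability: the used-constants cone of the route's items must stay
free of unproved named facts), so the route carries the glue as an OPEN support item and this file
is its certificate: `leadingTermPinchPrime_of_facts_of_children` closes that item the day the five
facts are discharged (one `exact`).

What is proved here (all `sorry`-free, standard axioms), by composing theorems LANDED by the line's
leads (G4, G5, G7–G12; control is the tree theorem
`Greenberg1999_coinvariantsRank_eq_selmerCorank_rat_holds`):

* `leadingTermPinchPrime_of_facts_of_children` — facts → A′ → S′ → `LeadingTerm.PinchPrime`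
  (the lead's composition `PinchPrime_of`, bridge G5 fed by G11);
* `leadingTermPinchPrime_of_facts_of_children'` — the same through the classical bridge G10
  (independent landed path);
* `leadingTermPinchPrime_of_factsConj_of_children` — the same with the facts bundled as ONE
  conjunction, literally `stub_theoremGradeFacts → A′ → S′ → PinchPrime` (the k = 3 reading);
* `leadingTermPinchPrime_children_of_standardConjectures` — PLAUSIBILITY: A′ and S′ follow from the
  Tate–Shafarevich conjecture (`ShaFiniteConjecture`) and Schneider's conjecture at every good
  ordinary `p ≥ 5` (hypotheses), so the children are no stronger than the standard conjectures;
* `leadingTermPinchPrime_childSha_of_shaPFinite` — DEDUP: A′ follows from the statement of the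
  shared item `SelmerRankShaPFinite` (`∀ W p, Finite Ш(W)[p^∞]`, routes SelmerRank / FrozenTwin),
  stated inline;
* `leadingTermPinchPrime_of_facts_of_samePrime` — the weaker SAME-PRIME sufficient pair (J, S″) of
  the lead's G12, recorded for the census (not filed: J is the analytic-rank-≥-2 slice of the crux in
  arithmetic words, by the content theorem).

References: Mazur–Stein–Tate 2006 Conj. 1.1; Greenberg LNM 1716 §1 Conj. 1.12, Thm 1.2; Kato,
Astérisque 295 (2004) Thm 17.4; Balakrishnan–Müller–Stein 2016 Thm 1.7 (PRS); Darmon 2004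
Thm 3.22 (GZK); Bertrand, LNM 1068 (1984) §3 Cor. 1; Burungale–Castella–Skinner (IMC under
irreducibility).
-/

noncomputable section

-- D-0017: single-problem summit, so `Summit.BirchSwinnertonDyer.BirchSwinnertonDyer.…` repeats a
-- namespace BY DESIGN.
set_option linter.dupNamespace false

namespace Summit.BirchSwinnertonDyer.BirchSwinnertonDyer.Theorems

open scoped MatrixGroups ModularForm
open CongruenceSubgroup Literature.NumberTheory.EllipticCurves
  Literature.NumberTheory.EllipticCurves.ModularForms
open Summit.BirchSwinnertonDyer.BirchSwinnertonDyer.Theses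
open Summit.BirchSwinnertonDyer.BirchSwinnertonDyer.Cruxes.PinchPrime.FirstLayerStability

/-- **Split certificate (k = 2 children + facts as hypotheses).** Modularity, the main conjecture
under irreducibility, Perrin-Riou–Schneider, Gross–Zagier–Kolyvagin and Bertrand (five published
theorems, hypotheses), together with the two children
(A′) cofinite finiteness of `Ш(E/ℚ)[p^∞]` over the good ordinary `p` for every curve of analytic
rank `≥ 2` and (S′) non-degeneracy of the canonical cyclotomic `p`-adic height at infinitely many
good ordinary `p ≥ 5` for every curve of rank `≥ 1` that is not CM of rank `1`,
give the crux `LeadingTerm.PinchPrime`. Proof = the lead's composition `PinchPrime_of`: the landed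
glue G11 (`stub_openStubs_of_residual`) turns (A′, S′) into the v16 pair (A, B) for every curve, and
the landed bridge G5 (`stub_pinchAt_of_openStubs`: modularity → BCS → control → A → B → crux body)
concludes; control is the tree theorem `Greenberg1999_coinvariantsRank_eq_selmerCorank_rat_holds`.
[cite: MazurSteinTate2006, Conj. 1.1] [cite: GreenbergLNM1716, §1 Conj. 1.12 and Thm 1.2]
[cite: BalakrishnanMullerStein2015, Thm. 1.7] [cite: Darmon2004, Thm. 3.22]
[cite: Bertrand1984ThetaCM, §3 Corollaire 1] -/
theorem leadingTermPinchPrime_of_facts_of_children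
    (hmod : exists_isNewformOf)
    (hBCS : burungale_castella_skinner_charIdeal_eq_padicLFunction)
    (hPRS : Schneider1985_order_charGenerator)
    (hGZK : rank_eq_analyticRank_of_analyticRank_le_one)
    (hBer : bertrand_pairing_self_ne_zero_of_hasCM)
    (hSha : ∀ (W : WeierstrassCurve ℚ) [W.IsElliptic] [W.IsGloballyMinimal], 2 ≤ W.analyticRank →
      ∃ B : Finset ℕ, ∀ p ∉ B, ∀ [Fact p.Prime], IsOrdinaryAt W p →
        Finite (AddCommGroup.primaryComponent W.sha p))
    (hSch : ∀ (W : WeierstrassCurve ℚ) [W.IsElliptic] [W.IsGloballyMinimal], 1 ≤ W.mordellWeilRank →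
      (W.HasCM → 2 ≤ W.mordellWeilRank) → ∀ B : Finset ℕ,
        ∃ p ∉ B, ∃ _ : Fact p.Prime, 5 ≤ p ∧ IsOrdinaryAt W p ∧
          ∀ Dh : WeierstrassCurve.PAdicHeightData W p, Dh.IsCanonical →
            WeierstrassCurve.SchneiderConjecture Dh) :
    LeadingTerm.PinchPrime := by
  obtain ⟨hA, hB⟩ := stub_openStubs_of_residual hPRS hmod hBCS hGZK hBer hSha hSch
  intro W _ _
  exact stub_pinchAt_of_openStubs hmod hBCS
    Greenberg1999_coinvariantsRank_eq_selmerCorank_rat_holds hA hB W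

/-- **The same certificate through the independent classical bridge G10**
(`stub_pinchAt_of_openRanges_schneider`, landed p136783): A′ verbatim, and Schneider at infinitely
many good ordinary `p ≥ 5` on `{r_an ≥ 2} ∪ {r_an = 1, non-CM}` supplied from S′ by the landed
`schneiderIO_of_residual` (rank `0`: `Reg_p = det ∅ = 1`; CM rank `≤ 1`: Bertrand).
[cite: MazurSteinTate2006, Conj. 1.1] [cite: Darmon2004, Thm. 3.22]
[cite: Bertrand1984ThetaCM, §3 Corollaire 1] -/
theorem leadingTermPinchPrime_of_facts_of_children'
    (hmod : exists_isNewformOf)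
    (hBCS : burungale_castella_skinner_charIdeal_eq_padicLFunction)
    (hPRS : Schneider1985_order_charGenerator)
    (hGZK : rank_eq_analyticRank_of_analyticRank_le_one)
    (hBer : bertrand_pairing_self_ne_zero_of_hasCM)
    (hSha : ∀ (W : WeierstrassCurve ℚ) [W.IsElliptic] [W.IsGloballyMinimal], 2 ≤ W.analyticRank →
      ∃ B : Finset ℕ, ∀ p ∉ B, ∀ [Fact p.Prime], IsOrdinaryAt W p →
        Finite (AddCommGroup.primaryComponent W.sha p))
    (hSch : ∀ (W : WeierstrassCurve ℚ) [W.IsElliptic] [W.IsGloballyMinimal], 1 ≤ W.mordellWeilRank →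
      (W.HasCM → 2 ≤ W.mordellWeilRank) → ∀ B : Finset ℕ,
        ∃ p ∉ B, ∃ _ : Fact p.Prime, 5 ≤ p ∧ IsOrdinaryAt W p ∧
          ∀ Dh : WeierstrassCurve.PAdicHeightData W p, Dh.IsCanonical →
            WeierstrassCurve.SchneiderConjecture Dh) :
    LeadingTerm.PinchPrime := by
  intro W _ _
  exact stub_pinchAt_of_openRanges_schneider hPRS
    Greenberg1999_coinvariantsRank_eq_selmerCorank_rat_holds hmod hBCS hGZK hBer hSha
    (fun W _ _ _ B ↦ schneiderIO_of_residual hBer hSch W B) W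

/-- **The k = 3 reading**: with the five facts bundled as ONE conjunction — literally the type of
the line's registered facts stub `stub_theoremGradeFacts` — the implication
`facts → A′ → S′ → LeadingTerm.PinchPrime` is a tree theorem. (This is the glue that would be used
by `--glue-by` if the facts conjunction were itself a route item; it is not filed as one because a
route item naming unproved Literature facts would make the route unstaffable.)
[cite: MazurSteinTate2006, Conj. 1.1] [cite: BalakrishnanMullerStein2015, Thm. 1.7] -/
theorem leadingTermPinchPrime_of_factsConj_of_children
    (hF : exists_isNewformOf ∧ burungale_castella_skinner_charIdeal_eq_padicLFunction ∧
      Schneider1985_order_charGenerator ∧ rank_eq_analyticRank_of_analyticRank_le_one ∧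
      bertrand_pairing_self_ne_zero_of_hasCM)
    (hSha : ∀ (W : WeierstrassCurve ℚ) [W.IsElliptic] [W.IsGloballyMinimal], 2 ≤ W.analyticRank →
      ∃ B : Finset ℕ, ∀ p ∉ B, ∀ [Fact p.Prime], IsOrdinaryAt W p →
        Finite (AddCommGroup.primaryComponent W.sha p))
    (hSch : ∀ (W : WeierstrassCurve ℚ) [W.IsElliptic] [W.IsGloballyMinimal], 1 ≤ W.mordellWeilRank →
      (W.HasCM → 2 ≤ W.mordellWeilRank) → ∀ B : Finset ℕ,
        ∃ p ∉ B, ∃ _ : Fact p.Prime, 5 ≤ p ∧ IsOrdinaryAt W p ∧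
          ∀ Dh : WeierstrassCurve.PAdicHeightData W p, Dh.IsCanonical →
            WeierstrassCurve.SchneiderConjecture Dh) :
    LeadingTerm.PinchPrime :=
  leadingTermPinchPrime_of_facts_of_children hF.1 hF.2.1 hF.2.2.1 hF.2.2.2.1 hF.2.2.2.2 hSha hSch

/-- **Plausibility of the children**: under the Tate–Shafarevich conjecture (`ShaFiniteConjecture`)
and Schneider's conjecture at every good ordinary `p ≥ 5` (both HYPOTHESES, asserted nowhere), the
two children A′ and S′ hold — they are range restrictions of the standard conjectures, so the split
does not strengthen the crux beyond what is universally believed.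
[cite: MazurSteinTate2006, Conj. 1.1] [cite: Tate1974, Conj. 1] -/
theorem leadingTermPinchPrime_children_of_standardConjectures
    (hShaC : ShaFiniteConjecture)
    (hSchC : ∀ (W : WeierstrassCurve ℚ) [W.IsElliptic] [W.IsGloballyMinimal] (p : ℕ) [Fact p.Prime],
      5 ≤ p → IsOrdinaryAt W p →
      ∀ Dh : WeierstrassCurve.PAdicHeightData W p, Dh.IsCanonical →
        WeierstrassCurve.SchneiderConjecture Dh) :
    (∀ (W : WeierstrassCurve ℚ) [W.IsElliptic] [W.IsGloballyMinimal], 2 ≤ W.analyticRank →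
      ∃ B : Finset ℕ, ∀ p ∉ B, ∀ [Fact p.Prime], IsOrdinaryAt W p →
        Finite (AddCommGroup.primaryComponent W.sha p)) ∧
    (∀ (W : WeierstrassCurve ℚ) [W.IsElliptic] [W.IsGloballyMinimal], 1 ≤ W.mordellWeilRank →
      (W.HasCM → 2 ≤ W.mordellWeilRank) → ∀ B : Finset ℕ,
        ∃ p ∉ B, ∃ _ : Fact p.Prime, 5 ≤ p ∧ IsOrdinaryAt W p ∧
          ∀ Dh : WeierstrassCurve.PAdicHeightData W p, Dh.IsCanonical →
            WeierstrassCurve.SchneiderConjecture Dh) := by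
  refine ⟨fun W _ _ _ ↦ ?_, fun W _ _ _ _ B ↦ ?_⟩
  · haveI : Finite W.sha := hShaC W ‹_›
    exact ⟨∅, fun p _ _ _ ↦ inferInstance⟩
  · obtain ⟨p, hpB, hp, h5, hord⟩ := exists_goodOrdinary_five_le_not_mem W B
    exact ⟨p, hpB, hp, h5, hord, fun Dh hDh ↦ hSchC W p h5 hord Dh hDh⟩

/-- **Dedup relation of child A′ with the shared item `SelmerRankShaPFinite`** (routes SelmerRank /
FrozenTwin; its statement `∀ W [IsElliptic] p [Fact p.Prime], Finite Ш(W)[p^∞]` inline as the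
hypothesis): it implies A′ with the empty exceptional set. So a proof of that item closes A′ in one
line, and A′ is the residual of it after Gross–Zagier–Kolyvagin (analytic rank `≤ 1`).
[cite: Tate1974, Conj. 1] -/
theorem leadingTermPinchPrime_childSha_of_shaPFinite
    (h : ∀ (W : WeierstrassCurve ℚ) [W.IsElliptic] (p : ℕ) [Fact p.Prime],
      Finite ↥(AddCommGroup.primaryComponent W.sha p)) :
    ∀ (W : WeierstrassCurve ℚ) [W.IsElliptic] [W.IsGloballyMinimal], 2 ≤ W.analyticRank →
      ∃ B : Finset ℕ, ∀ p ∉ B, ∀ [Fact p.Prime], IsOrdinaryAt W p →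
        Finite (AddCommGroup.primaryComponent W.sha p) :=
  fun W _ _ _ ↦ ⟨∅, fun p _ _ _ ↦ h W p⟩

/-- **The weaker same-prime sufficient pair (J, S″)** of the lead's G12
(`stub_pinchAt_of_samePrime`, landed p138339), recorded for the strategy census: (J) every curve of
analytic rank `≥ 2` has ONE good ordinary `p ≥ 5` with `E[p]` irreducible, `Ш[p^∞]` finite and the
canonical height non-degenerate; (S″) every non-CM curve of analytic rank `1` has ONE good ordinary
`p ≥ 5` with `E[p]` irreducible and the canonical height non-degenerate. Modulo the five facts they
give the crux. NOT filed as the split: (J) keeps the same-prime conjunction inside one item and is,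
by the content theorem (`Negative/ContentOfCrux`, G13), the analytic-rank-≥-2 slice of the crux in
arithmetic words. [cite: BalakrishnanMullerStein2015, Thm. 1.7] [cite: MazurSteinTate2006, Conj. 1.1]
[cite: Darmon2004, Thm. 3.22] -/
theorem leadingTermPinchPrime_of_facts_of_samePrime
    (hmod : exists_isNewformOf)
    (hBCS : burungale_castella_skinner_charIdeal_eq_padicLFunction)
    (hPRS : Schneider1985_order_charGenerator)
    (hGZK : rank_eq_analyticRank_of_analyticRank_le_one)
    (hBer : bertrand_pairing_self_ne_zero_of_hasCM)
    (hJ : ∀ (W : WeierstrassCurve ℚ) [W.IsElliptic] [W.IsGloballyMinimal], 2 ≤ W.analyticRank →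
      ∃ (p : ℕ) (_ : Fact p.Prime), 5 ≤ p ∧ IsOrdinaryAt W p ∧ W.HasIrreducibleModPGaloisRep p ∧
        Finite (AddCommGroup.primaryComponent W.sha p) ∧
        ∀ Dh : WeierstrassCurve.PAdicHeightData W p, Dh.IsCanonical →
          WeierstrassCurve.SchneiderConjecture Dh)
    (hS : ∀ (W : WeierstrassCurve ℚ) [W.IsElliptic] [W.IsGloballyMinimal], W.analyticRank = 1 →
      ¬ W.HasCM →
      ∃ (p : ℕ) (_ : Fact p.Prime), 5 ≤ p ∧ IsOrdinaryAt W p ∧ W.HasIrreducibleModPGaloisRep p ∧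
        ∀ Dh : WeierstrassCurve.PAdicHeightData W p, Dh.IsCanonical →
          WeierstrassCurve.SchneiderConjecture Dh) :
    LeadingTerm.PinchPrime :=
  fun W _ _ ↦ stub_pinchAt_of_samePrime hPRS hmod hBCS hGZK hBer hJ hS W

end Summit.BirchSwinnertonDyer.BirchSwinnertonDyer.Theorems

end
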